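import Literature.NumberTheory.GaloisRepresentations.CohomologicalDimensionTowerProofs
import Literature.NumberTheory.GaloisRepresentations.GaloisCohomologyProofs
import Mathlib.GroupTheory.SpecificGroups.Cyclic.Basic
import HarnessLib

/-!
# `H²` of a finite cyclic group vanishes when the invariants are norms (Serre, *Corps locaux* VIII §4)

For a finite cyclic group `C = ⟨s⟩` acting on a module `B`, `H²(C, B) ≅ Ĥ⁰(C, B) = B^C / N B`
(Serre, *Corps locaux*, VIII §4; the step "`H²(P/N, (E^N)ˣ) ≅ Ĥ⁰ = (E^P)ˣ / N (E^N)ˣ = 0`" of the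
proof of Serre II §3.1 Prop. 5 via *Local Fields* X §7 Prop. 11).  This file proves the
vanishing consequence for Mathlib's continuous cohomology of the finite discrete group `C` with
discrete coefficients:

* `subsingleton_two_of_forall_exists_norm_eq` — if every `C`-invariant element of `B` is a norm
  `N b = Σ_{c ∈ C} c b`, then `H²(C, B) = 0`.

Proof (dimension shifting inside `C`, no periodicity isomorphism needed): with
`I = C(C, B) ⊇ B` the coinduced module and `Q = I/B`, `H²(C, B) = 0` follows from
`H¹(C, Q) = 0` (`IsSES.subsingleton_X₁`, `I` being acyclic); a continuous crossed homomorphism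
`φ : C → Q` is determined by `q = φ(s)`, which satisfies `N q = 0`, and `φ` is principal as soon
as `q = s m - m`; finally `N q = 0 ⇒ q ∈ (s - 1) Q` (`exists_eq_sub_of_norm_eq_zero`): lift `q`
to `ĩ ∈ I`, `N ĩ` is a constant `b₀ ∈ B^C`, a norm `N b'` by hypothesis, so `ĩ - b'` has norm `0`
and is of the form `s j - j` because `Ĥ⁻¹(C, I) = 0` for the coinduced module
(`exists_shift_sub_of_sum_eq_zero`: a function on `⟨s⟩` with total sum `0` is a difference of
consecutive partial sums).

## References

* J.-P. Serre, *Corps locaux* / *Local Fields*, GTM 67 (1979), VIII §4 (cohomology of cyclic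
  groups), X §7 Prop. 11. [SerreLocalFields1979]
* J.-P. Serre, *Cohomologie galoisienne* / *Galois Cohomology* (1997), II §3.1 Prop. 5
  ((iv) ⇒ (iii) ⇒ (ii), "[145], p. 169"). [SerreGaloisCohomology1997]
-/

noncomputable section

open CategoryTheory Topology

universe u

namespace Literature.NumberTheory.GaloisRepresentations

open _root_.TopRep _root_.ContRepresentation _root_.ContinuousCohomology

/-! ### Cyclic groups: indexing by powers of a generator -/

section Cyclic

variable {C : Type*} [Group C] [Fintype C] (s : C) (hs : ∀ x : C, x ∈ Subgroup.zpowers s)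

/-- The bijection `i ↦ s ^ i` from `Fin (orderOf s)` onto the cyclic group generated by `s`
(Mathlib `finEquivZPowers`). [folklore] -/
def powEquiv : Fin (orderOf s) ≃ C :=
  (finEquivZPowers (isOfFinOrder_of_finite s)).trans (Equiv.subtypeUnivEquiv hs)

/-- `powEquiv i = s ^ i`. [folklore] -/
@[simp] theorem powEquiv_apply (i : Fin (orderOf s)) : powEquiv s hs i = s ^ (i : ℕ) := rfl

include hs in
/-- Sums over the cyclic group are sums over the exponents `0, …, orderOf s - 1`. [folklore] -/
theorem sum_eq_sum_range_pow {B : Type*} [AddCommMonoid B] (u : C → B) :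
    ∑ y, u y = ∑ j ∈ Finset.range (orderOf s), u (s ^ j) := by
  rw [← Equiv.sum_comp (powEquiv s hs), ← Fin.sum_univ_eq_sum_range (fun j => u (s ^ j))]
  rfl

/-- `s⁻¹ = s ^ (orderOf s - 1)`. [folklore] -/
theorem inv_eq_pow_orderOf_sub_one : s⁻¹ = s ^ (orderOf s - 1) := by
  symm
  apply eq_inv_of_mul_eq_one_left
  rw [← pow_succ, Nat.sub_add_cancel (orderOf_pos s), pow_orderOf_eq_one]

include hs in
/-- **A function on a finite cyclic group `⟨s⟩` with total sum zero is `x ↦ v(s⁻¹ x) - v(x)`**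
for some `v` (partial sums along `1, s, s², …`; this is `Ĥ⁻¹ = 0` for the regular module).
[cite: SerreLocalFields1979, VIII §4] -/
theorem exists_shift_sub_of_sum_eq_zero {B : Type*} [AddCommGroup B] (u : C → B)
    (hu : ∑ y, u y = 0) : ∃ v : C → B, ∀ x, u x = v (s⁻¹ * x) - v x := by
  have hn : 0 < orderOf s := orderOf_pos s
  -- `v x = -(u 1 + u s + ⋯ + u (s ^ i))` for `x = s ^ i`, `i < orderOf s`
  refine ⟨fun x => -∑ j ∈ Finset.range (((powEquiv s hs).symm x : ℕ) + 1), u (s ^ j),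
    fun x => ?_⟩
  rw [neg_sub_neg]
  obtain ⟨⟨i, hi⟩, rfl⟩ := (powEquiv s hs).surjective x
  rw [Equiv.symm_apply_apply, powEquiv_apply]
  cases i with
  | zero =>
    -- `x = 1`, `s⁻¹ = s ^ (n - 1)`, and the full sum vanishes
    have hinv : s⁻¹ * s ^ ((⟨0, hi⟩ : Fin (orderOf s)) : ℕ) =
        powEquiv s hs ⟨orderOf s - 1, Nat.sub_lt hn Nat.one_pos⟩ := by
      rw [powEquiv_apply]
      change s⁻¹ * s ^ 0 = s ^ (orderOf s - 1)
      rw [pow_zero, mul_one, inv_eq_pow_orderOf_sub_one]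
    rw [hinv, Equiv.symm_apply_apply]
    change u (s ^ 0) = ∑ j ∈ Finset.range (0 + 1), u (s ^ j) -
      ∑ j ∈ Finset.range (orderOf s - 1 + 1), u (s ^ j)
    rw [zero_add, Finset.sum_range_one, Nat.sub_add_cancel hn, ← sum_eq_sum_range_pow s hs u,
      hu, sub_zero]
  | succ k =>
    have hk : k < orderOf s := Nat.lt_of_succ_lt hi
    have hinv : s⁻¹ * s ^ ((⟨k + 1, hi⟩ : Fin (orderOf s)) : ℕ) = powEquiv s hs ⟨k, hk⟩ := by
      rw [powEquiv_apply]
      change s⁻¹ * s ^ (k + 1) = s ^ k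
      rw [pow_succ', inv_mul_cancel_left]
    rw [hinv, Equiv.symm_apply_apply]
    change u (s ^ (k + 1)) = ∑ j ∈ Finset.range (k + 1 + 1), u (s ^ j) -
      ∑ j ∈ Finset.range (k + 1), u (s ^ j)
    rw [Finset.sum_range_succ _ (k + 1), add_sub_cancel_left]

end Cyclic

/-! ### The norm element and crossed homomorphisms of a cyclic group -/

section Norm

variable {C : Type u} [Group C] [TopologicalSpace C] [Fintype C]
variable {k : Type*} [CommRing k] [TopologicalSpace k]
variable {B : Type u} [AddCommGroup B] [Module k B] [TopologicalSpace B]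
variable (ρ : ContinuousRep C k B)

-- The statements of this section are coefficient-generic so that they apply verbatim to
-- quotient modules such as `coindQuot` (whose `ℤ`-module structure is Mathlib's quotient one).
/-- Unfolding Mathlib's norm `Representation.norm` (`N = Σ_{c ∈ C} ρ c`) on a continuous
representation: `N b = Σ_c c b`. [cite: SerreLocalFields1979, VIII §1] -/
theorem norm_apply (b : B) : ρ.toRepresentation.norm b = ∑ c : C, ρ c b := by
  simp only [Representation.norm, LinearMap.coe_sum, Finset.sum_apply]
  rfl

omit [Fintype C] in
/-- On powers of `s`, a crossed homomorphism `φ` (`φ(g h) = φ g + g φ h`) is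
`φ(sⁱ) = Σ_{j<i} sʲ φ(s)`. [cite: SerreLocalFields1979, VIII §4] -/
theorem crossed_apply_pow (φ : C → B) (hφ : ∀ g h, φ (g * h) = φ g + ρ g (φ h)) (s : C) :
    ∀ i : ℕ, φ (s ^ i) = ∑ j ∈ Finset.range i, ρ (s ^ j) (φ s)
  | 0 => by
    have h1 : φ 1 = φ 1 + φ 1 := by
      have := hφ 1 1
      rwa [mul_one, map_one, Module.End.one_apply] at this
    rw [pow_zero, Finset.sum_range_zero]
    exact left_eq_add.1 h1
  | i + 1 => by rw [pow_succ, hφ, crossed_apply_pow φ hφ s i, Finset.sum_range_succ]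

omit [Fintype C] in
/-- If `φ(s) = s m - m` then `φ(sⁱ) = sⁱ m - m` for a crossed homomorphism `φ`. [folklore] -/
theorem crossed_apply_pow_of_eq (φ : C → B) (hφ : ∀ g h, φ (g * h) = φ g + ρ g (φ h)) (s : C)
    (m : B) (hm : φ s = ρ s m - m) : ∀ i : ℕ, φ (s ^ i) = ρ (s ^ i) m - m
  | 0 => by
    rw [crossed_apply_pow ρ φ hφ s 0, Finset.sum_range_zero, pow_zero, map_one,
      Module.End.one_apply, sub_self]
  | i + 1 => by
    rw [pow_succ, hφ, crossed_apply_pow_of_eq φ hφ s m hm i, hm, map_sub, ← Module.End.mul_apply,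
      ← map_mul]
    abel

end Norm

/-! ### `N q = 0 ⇒ q ∈ (s - 1) Q` for the dimension-shifting quotient `Q = C(C, B)/B` -/

section Shift

variable {C : Type u} [Group C] [TopologicalSpace C] [DiscreteTopology C] [IsTopologicalGroup C]
  [Fintype C]
variable {B : Type u} [AddCommGroup B] [TopologicalSpace B] [DiscreteTopology B]
variable (ρ : ContinuousRep C ℤ B) (s : C) (hs : ∀ x : C, x ∈ Subgroup.zpowers s)

include hs in
/-- **`Ĥ⁻¹(C, C(C, B)) = 0` for the coinduced module**: an `f ∈ C(C, B)` with `Σ_c c f = 0`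
(twisted action `(c f)(x) = c f(c⁻¹ x)`) is of the form `s j - j` (untwist by
`u(x) = x⁻¹ f(x)` and apply `exists_shift_sub_of_sum_eq_zero`). [cite: SerreLocalFields1979, VIII §4] -/
theorem exists_eq_apply_sub_coind (f : C(C, B)) (hf : ρ.coind.toRepresentation.norm f = 0) :
    ∃ j : C(C, B), f = ρ.coind s j - j := by
  -- untwist
  let u : C → B := fun x => ρ x⁻¹ (f x)
  have hu : ∑ y, u y = 0 := by
    have h1 := DFunLike.congr_fun hf (1 : C)
    rw [norm_apply, ContinuousMap.coe_sum, Finset.sum_apply, ContinuousMap.zero_apply] at h1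
    rw [← Equiv.sum_comp (Equiv.inv C)]
    refine (Fintype.sum_congr _ _ fun c => ?_).symm.trans h1
    rw [ContinuousRep.coind_apply_apply, mul_one, Equiv.inv_apply]
    change ρ c (f c⁻¹) = ρ c⁻¹⁻¹ (f c⁻¹)
    rw [inv_inv]
  obtain ⟨v, hv⟩ := exists_shift_sub_of_sum_eq_zero s hs u hu
  refine ⟨⟨fun x => ρ x (v x), continuous_of_discreteTopology⟩, ContinuousMap.ext fun x => ?_⟩
  rw [ContinuousMap.sub_apply, ContinuousRep.coind_apply_apply]
  change f x = ρ s (ρ (s⁻¹ * x) (v (s⁻¹ * x))) - ρ x (v x)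
  rw [← Module.End.mul_apply, ← map_mul, mul_inv_cancel_left, ← map_sub, ← hv]
  change f x = ρ x (ρ x⁻¹ (f x))
  rw [← Module.End.mul_apply, ← map_mul, mul_inv_cancel, map_one, Module.End.one_apply]

include hs in
/-- **`N q = 0 ⇒ q = s m - m` in `Q = C(C, B)/B`, when every invariant of `B` is a norm**: lift
`q` to `ĩ`; `N ĩ` is a constant function with `C`-invariant value, hence the constant `N b'`;
then `ĩ - b'` has norm zero and `exists_eq_apply_sub_coind` applies. [cite: SerreLocalFields1979, VIII §4] -/
theorem exists_eq_apply_sub_of_norm_eq_zero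
    (hN : ∀ b : B, (∀ c : C, ρ c b = b) → ∃ b' : B, ρ.toRepresentation.norm b' = b)
    (q : C(C, B) ⧸ ρ.constSubmodule) (hq : ρ.coindQuot.toRepresentation.norm q = 0) :
    ∃ m : C(C, B) ⧸ ρ.constSubmodule, q = ρ.coindQuot s m - m := by
  obtain ⟨i, rfl⟩ := ρ.coindπ_surjective q
  -- `N ĩ` is a constant `b₀`
  have hπN : ρ.coindπ.hom (ρ.coind.toRepresentation.norm i) = 0 := by
    rw [norm_apply, map_sum, ← hq, norm_apply]
    exact Finset.sum_congr rfl fun c _ => TopRep.hom_comm_apply ρ.coindπ c i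
  obtain ⟨b₀, hb₀⟩ := ρ.coind_exact_mid _ hπN
  -- `b₀` is invariant
  have hb₀inv : ∀ c : C, ρ c b₀ = b₀ := fun c => ρ.coindι_injective
    ((TopRep.hom_comm_apply ρ.coindι c b₀).trans (by
      rw [hb₀]
      exact Representation.self_norm_apply ρ.coind.toRepresentation c i))
  obtain ⟨b', hb'⟩ := hN b₀ hb₀inv
  -- `ĩ - b'` has norm zero
  have hN0 : ρ.coind.toRepresentation.norm (i - ρ.coindι.hom b') = 0 := by
    rw [map_sub, ← hb₀, sub_eq_zero, norm_apply, ← hb', norm_apply, map_sum]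
    exact Finset.sum_congr rfl fun c _ => (TopRep.hom_comm_apply ρ.coindι c b').symm
  obtain ⟨j, hj⟩ := exists_eq_apply_sub_coind ρ s hs _ hN0
  refine ⟨ρ.coindπ.hom j, ?_⟩
  have h1 : ρ.coindπ.hom i = ρ.coindπ.hom (i - ρ.coindι.hom b') := by
    rw [map_sub, show ρ.coindπ.hom (ρ.coindι.hom b') = 0 from
      congr(($(ρ.coindι_comp_coindπ)).hom b'), sub_zero]
  rw [h1, hj, map_sub]
  exact congrArg (· - ρ.coindπ.hom j) (TopRep.hom_comm_apply ρ.coindπ s j)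

/-! ### `H¹(C, Q) = 0` and `H²(C, B) = 0` -/

include hs in
/-- **`H¹(C, Q) = 0`** for `Q = C(C, B)/B` when every invariant of `B` is a norm: a continuous
crossed homomorphism `φ : C → Q` has `N φ(s) = φ(s^{|C|}) = 0`, so `φ(s) = s m - m` and then
`φ(sⁱ) = sⁱ m - m` for all `i`. [cite: SerreLocalFields1979, VIII §4] -/
theorem subsingleton_one_coindQuot
    (hN : ∀ b : B, (∀ c : C, ρ c b = b) → ∃ b' : B, ρ.toRepresentation.norm b' = b) :
    Subsingleton (continuousCohomology 1 ρ.coindQuot.toTopRep) := by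
  refine ContinuousCohomology.subsingleton_one_of_inhomogeneous ρ.coindQuot.toTopRep
    fun φ hφ => ?_
  have hφ' : ∀ g h, φ (g * h) = φ g + ρ.coindQuot g (φ h) := hφ
  -- `N φ(s) = 0`
  have hNq : ρ.coindQuot.toRepresentation.norm (φ s) = 0 := by
    rw [norm_apply, sum_eq_sum_range_pow s hs, ← crossed_apply_pow ρ.coindQuot φ hφ' s,
      pow_orderOf_eq_one, ← pow_zero s, crossed_apply_pow ρ.coindQuot φ hφ' s 0,
      Finset.sum_range_zero]
  obtain ⟨m, hm⟩ := exists_eq_apply_sub_of_norm_eq_zero ρ s hs hN (φ s) hNq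
  refine ⟨m, fun g => ?_⟩
  obtain ⟨i, rfl⟩ := (powEquiv s hs).surjective g
  rw [powEquiv_apply]
  exact crossed_apply_pow_of_eq ρ.coindQuot φ hφ' s m hm i

include hs in
/-- **`H²(C, B) = 0` for a finite cyclic group when every invariant is a norm** (Serre, *Corps
locaux* VIII §4: `H²(C, B) = Ĥ⁰(C, B) = B^C / N B`; here only the vanishing, by dimension
shifting `0 → B → C(C, B) → Q → 0` with `H¹(C, Q) = 0`, `subsingleton_one_coindQuot`).
[cite: SerreLocalFields1979, VIII §4] [cite: SerreGaloisCohomology1997, II §3.1 Prop. 5 ((iv) ⇒ (ii))] -/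
theorem subsingleton_two_of_forall_exists_norm_eq
    (hN : ∀ b : B, (∀ c : C, ρ c b = b) → ∃ b' : B, ρ.toRepresentation.norm b' = b) :
    Subsingleton (continuousCohomology 2 ρ.toTopRep) :=
  (isSES_coind ρ).subsingleton_X₁ 0 (subsingleton_one_coindQuot ρ s hs hN)
    (subsingleton_coind ρ 1)

end Shift

end Literature.NumberTheory.GaloisRepresentations

end
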